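import Summits.QuantumFields.YangMills.Theorems.OnsetSkewLawRPOnsetFloorPositiveTimeSynthesisCollar
import Literature.MathematicalPhysics.QuantumLattice.SchwartzFourierDensity
import Mathlib.Analysis.Complex.OperatorNorm
import Mathlib.Analysis.Calculus.BumpFunction.Basic
import HarnessLib

/-!
# Slot functions `χ((w−c)/ρ) · e^{2πi κ·((w−c)/(4ρ)+h)}`: derivative bounds and atomic synthesis per slot

Helper toward the registered stub `stub_tensorisation` of crux AtomicSynthesis ⟨stmt-QuantumFields-28126⟩
(LINE «SlotwiseSynthesis», ym-idea-11 g13).  The single-slot functions that appear when the product Fourier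
expansion of an `n`-slot Schwartz function is cut off slot by slot are `Θ(w) = χ(ρ⁻¹(w − c)) e_κ(4⁻¹ρ⁻¹(w − c) + h)`
(`χ` a bump `= 1` on the unit ball, supported in the ball of radius `3/2`; `e_κ = eChar κ` the character of
`κ ∈ ℤ⁴`).  We prove

* `norm_iteratedFDeriv_comp_smul_sub_le` — `‖D^m (f(a(· − c)))‖ ≤ |a|^m ‖D^m f‖` (chain rule with a homothety);
* `norm_iteratedFDeriv_eChar_affine_le` — `‖D^m (u ↦ e_κ(a u + h))‖ ≤ (2π|κ|₁|a|)^m`;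
* `norm_iteratedFDeriv_bump_smul_eChar_le` — **Leibniz**: `‖D^m (χ · e_κ(4⁻¹· + h))‖ ≤ B (1 + (π/2)|κ|₁)^m`;
* `slot_hasSum_atoms` — **the slot synthesis**: under `SlotSynth b C₁ N₁` (the landed single-slot property,
  `RPOnsetFloorPosTimeSynthCollar.SlotSynth`), `Θ` is an absolutely convergent COMPLEX `ℓ¹` series of `b`-atoms of
  scales `≤ ρ` centred within `2ρ` of `c`, with total mass `≤ 2 C₁ B (1 + (π/2)|κ|₁)^{N₁}` (real and imaginary
  parts synthesised separately and interleaved on `ℕ ⊕ ℕ`).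

HONEST LABEL: elementary analysis bookkeeping; no crux / rung / summit statement is proved here; the
Yang–Mills mass gap is NOT proved by this file.  Cell `ym-idea-1`, width seat `ym-line-sfw-p2-w3` g37 (free hands).
-/

noncomputable section

open Set Function Filter Topology MeasureTheory Complex
open Literature.MathematicalPhysics.QuantumLattice (eChar absSum contDiff_eChar norm_eChar absSum_nonneg
  norm_iteratedFDeriv_eChar_le)
open Summit.QuantumFields.YangMills.Theorems.RPOnsetFloorPosTimeSynthCollar (SlotSynth)
open scoped ContDiff Real

namespace Summit.QuantumFields.YangMills.Theorems.AtomicSynthesisTensor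

/-! ## Chain rule with a homothety -/

section Homothety

variable {E F : Type*} [NormedAddCommGroup E] [NormedSpace ℝ E] [NormedAddCommGroup F] [NormedSpace ℝ F]

/-- **`‖D^m (w ↦ f (a • (w − c))) (w)‖ ≤ |a|^m ‖D^m f (a • (w − c))‖`.** [folklore] -/
theorem norm_iteratedFDeriv_comp_smul_sub_le {f : E → F} {n : WithTop ℕ∞} (hf : ContDiff ℝ n f) (a : ℝ) (c : E)
    {m : ℕ} (hm : (m : WithTop ℕ∞) ≤ n) (w : E) :
    ‖iteratedFDeriv ℝ m (fun w => f (a • (w - c))) w‖ ≤ |a| ^ m * ‖iteratedFDeriv ℝ m f (a • (w - c))‖ := by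
  set L : E →L[ℝ] E := a • ContinuousLinearMap.id ℝ E with hL
  have hLw : ∀ v : E, L v = a • v := fun v => by simp [hL]
  have h1 : (fun w => f (a • (w - c))) = fun w => (f ∘ L) (w - c) := by
    funext w; simp only [Function.comp_apply, hLw]
  rw [h1, iteratedFDeriv_comp_sub, ContinuousLinearMap.iteratedFDeriv_comp_right _ hf _ hm]
  refine (ContinuousMultilinearMap.norm_compContinuousLinearMap_le _ _).trans ?_
  rw [Finset.prod_const, Finset.card_univ, Fintype.card_fin, mul_comm]
  have ha : ‖L‖ ≤ |a| := by
    refine ContinuousLinearMap.opNorm_le_bound _ (abs_nonneg a) fun v => ?_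
    rw [hLw, norm_smul, Real.norm_eq_abs]
  rw [hLw]
  exact mul_le_mul_of_nonneg_right (pow_le_pow_left₀ (norm_nonneg _) ha m) (norm_nonneg _)

end Homothety

/-! ## The character factor and the unit-scale slot function -/

section Character

variable {ι : Type*} [Fintype ι]

/-- **`‖D^m (u ↦ e_κ(a • u + h)) (u)‖ ≤ (2π |κ|₁ |a|)^m`.** [folklore] -/
theorem norm_iteratedFDeriv_eChar_affine_le (κ : ι → ℤ) (a : ℝ) (h : EuclideanSpace ℝ ι) (m : ℕ)
    (u : EuclideanSpace ℝ ι) :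
    ‖iteratedFDeriv ℝ m (fun u : EuclideanSpace ℝ ι => eChar κ (a • u + h)) u‖ ≤ (2 * π * absSum κ * |a|) ^ m := by
  have h1 : (fun u : EuclideanSpace ℝ ι => eChar κ (a • u + h)) =
      fun u => (fun v => eChar κ (v + h)) (a • (u - 0)) := by
    funext u; simp
  rw [h1]
  have hsm : ContDiff ℝ ∞ (fun v : EuclideanSpace ℝ ι => eChar κ (v + h)) :=
    (contDiff_eChar κ).comp (contDiff_id.add contDiff_const)
  refine (norm_iteratedFDeriv_comp_smul_sub_le hsm a 0 (by exact_mod_cast le_top) u).trans ?_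
  rw [iteratedFDeriv_comp_add_right]
  calc |a| ^ m * ‖iteratedFDeriv ℝ m (eChar κ) (a • (u - 0) + h)‖
      ≤ |a| ^ m * (2 * π * absSum κ) ^ m :=
        mul_le_mul_of_nonneg_left (norm_iteratedFDeriv_eChar_le κ m _) (pow_nonneg (abs_nonneg a) m)
    _ = (2 * π * absSum κ * |a|) ^ m := by ring

/-- **Leibniz bound for the unit-scale slot function** `Θ₁(u) = χ(u) e_κ(4⁻¹u + h)`:
`‖D^m Θ₁‖ ≤ B (1 + (π/2)|κ|₁)^m` whenever `‖D^i χ‖ ≤ B` for `i ≤ N₁` and `m ≤ N₁`. [folklore] -/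
theorem norm_iteratedFDeriv_bump_smul_eChar_le (χ : ContDiffBump (0 : EuclideanSpace ℝ ι)) {N₁ : ℕ} {B : ℝ}
    (hB : ∀ i, i ≤ N₁ → ∀ y, ‖iteratedFDeriv ℝ i (fun y => χ y) y‖ ≤ B) (κ : ι → ℤ)
    (h : EuclideanSpace ℝ ι) {m : ℕ} (hm : m ≤ N₁) (u : EuclideanSpace ℝ ι) :
    ‖iteratedFDeriv ℝ m (fun u : EuclideanSpace ℝ ι => χ u • eChar κ ((4 : ℝ)⁻¹ • u + h)) u‖ ≤
      B * (1 + π / 2 * absSum κ) ^ m := by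
  have hχ : ContDiff ℝ ∞ (fun y => χ y) := χ.contDiff
  have he : ContDiff ℝ ∞ (fun u : EuclideanSpace ℝ ι => eChar κ ((4 : ℝ)⁻¹ • u + h)) :=
    (contDiff_eChar κ).comp ((contDiff_const_smul _).add contDiff_const)
  have hB0 : 0 ≤ B := (norm_nonneg _).trans (hB 0 (Nat.zero_le _) 0)
  refine (norm_iteratedFDeriv_smul_le hχ he u (n := m) (by exact_mod_cast le_top)).trans ?_
  have hterm : ∀ i ∈ Finset.range (m + 1),
      (m.choose i : ℝ) * ‖iteratedFDeriv ℝ i (fun y => χ y) u‖ *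
        ‖iteratedFDeriv ℝ (m - i) (fun u : EuclideanSpace ℝ ι => eChar κ ((4 : ℝ)⁻¹ • u + h)) u‖ ≤
      (1 : ℝ) ^ i * (π / 2 * absSum κ) ^ (m - i) * (m.choose i : ℝ) * B := by
    intro i hi
    have hi' : i ≤ N₁ := (Nat.lt_succ_iff.1 (Finset.mem_range.1 hi)).trans hm
    have h2 := norm_iteratedFDeriv_eChar_affine_le κ (4 : ℝ)⁻¹ h (m - i) u
    rw [abs_of_pos (by norm_num : (0 : ℝ) < 4⁻¹),
      show 2 * π * absSum κ * (4 : ℝ)⁻¹ = π / 2 * absSum κ by ring] at h2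
    calc (m.choose i : ℝ) * ‖iteratedFDeriv ℝ i (fun y => χ y) u‖ *
          ‖iteratedFDeriv ℝ (m - i) (fun u : EuclideanSpace ℝ ι => eChar κ ((4 : ℝ)⁻¹ • u + h)) u‖
        ≤ (m.choose i : ℝ) * B * (π / 2 * absSum κ) ^ (m - i) := by
          refine mul_le_mul (mul_le_mul_of_nonneg_left (hB i hi' u) (Nat.cast_nonneg _)) h2 (norm_nonneg _) ?_
          exact mul_nonneg (Nat.cast_nonneg _) hB0
      _ = (1 : ℝ) ^ i * (π / 2 * absSum κ) ^ (m - i) * (m.choose i : ℝ) * B := by ring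
  refine (Finset.sum_le_sum hterm).trans (le_of_eq ?_)
  rw [← Finset.sum_mul, ← add_pow, mul_comm]

/-- The same bound at the top order: `‖D^m Θ₁‖ ≤ B (1 + (π/2)|κ|₁)^{N₁}` for `m ≤ N₁`. [folklore] -/
theorem norm_iteratedFDeriv_bump_smul_eChar_le' (χ : ContDiffBump (0 : EuclideanSpace ℝ ι)) {N₁ : ℕ} {B : ℝ}
    (hB : ∀ i, i ≤ N₁ → ∀ y, ‖iteratedFDeriv ℝ i (fun y => χ y) y‖ ≤ B) (κ : ι → ℤ)
    (h : EuclideanSpace ℝ ι) {m : ℕ} (hm : m ≤ N₁) (u : EuclideanSpace ℝ ι) :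
    ‖iteratedFDeriv ℝ m (fun u : EuclideanSpace ℝ ι => χ u • eChar κ ((4 : ℝ)⁻¹ • u + h)) u‖ ≤
      B * (1 + π / 2 * absSum κ) ^ N₁ := by
  have hB0 : 0 ≤ B := (norm_nonneg _).trans (hB 0 (Nat.zero_le _) 0)
  refine (norm_iteratedFDeriv_bump_smul_eChar_le χ hB κ h hm u).trans ?_
  have h1 : (1 : ℝ) ≤ 1 + π / 2 * absSum κ := le_add_of_nonneg_right (by positivity [absSum_nonneg κ])
  exact mul_le_mul_of_nonneg_left (pow_le_pow_right₀ h1 hm) hB0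

end Character

/-! ## The scaled slot function: support and derivative bounds -/

section Scaled

variable {ι : Type*} [Fintype ι]

/-- **Derivative bounds of the scaled slot function** `Θ(w) = χ(ρ⁻¹(w − c)) e_κ(4⁻¹ρ⁻¹(w − c) + h)`:
`‖D^m Θ (w)‖ ≤ B (1 + (π/2)|κ|₁)^{N₁} / ρ^m` for `m ≤ N₁`. [folklore] -/
theorem norm_iteratedFDeriv_slot_le (χ : ContDiffBump (0 : EuclideanSpace ℝ ι)) {N₁ : ℕ} {B : ℝ}
    (hB : ∀ i, i ≤ N₁ → ∀ y, ‖iteratedFDeriv ℝ i (fun y => χ y) y‖ ≤ B) (κ : ι → ℤ)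
    (h c : EuclideanSpace ℝ ι) {ρ : ℝ} (hρ : 0 < ρ) {m : ℕ} (hm : m ≤ N₁) (w : EuclideanSpace ℝ ι) :
    ‖iteratedFDeriv ℝ m (fun w : EuclideanSpace ℝ ι =>
        χ (ρ⁻¹ • (w - c)) • eChar κ ((4 : ℝ)⁻¹ • (ρ⁻¹ • (w - c)) + h)) w‖ ≤
      B * (1 + π / 2 * absSum κ) ^ N₁ / ρ ^ m := by
  have hsm : ContDiff ℝ ∞ (fun u : EuclideanSpace ℝ ι => χ u • eChar κ ((4 : ℝ)⁻¹ • u + h)) :=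
    χ.contDiff.smul ((contDiff_eChar κ).comp ((contDiff_const_smul _).add contDiff_const))
  have h1 := norm_iteratedFDeriv_comp_smul_sub_le hsm ρ⁻¹ c (m := m) (by exact_mod_cast le_top) w
  refine h1.trans ?_
  rw [abs_of_pos (inv_pos.2 hρ), inv_pow, div_eq_inv_mul]
  exact mul_le_mul_of_nonneg_left (norm_iteratedFDeriv_bump_smul_eChar_le' χ hB κ h hm _)
    (inv_nonneg.2 (pow_nonneg hρ.le m))

/-- **Support of the scaled slot function**: if `χ.rOut = 3/2` then `Θ` vanishes off the open ball
`B(c, 3ρ/2)`. [folklore] -/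
theorem slot_eq_zero_of_le (χ : ContDiffBump (0 : EuclideanSpace ℝ ι)) (hχ : χ.rOut = 3 / 2) (κ : ι → ℤ)
    (h c : EuclideanSpace ℝ ι) {ρ : ℝ} (hρ : 0 < ρ) {w : EuclideanSpace ℝ ι} (hw : 3 / 2 * ρ ≤ ‖w - c‖) :
    χ (ρ⁻¹ • (w - c)) • eChar κ ((4 : ℝ)⁻¹ • (ρ⁻¹ • (w - c)) + h) = 0 := by
  have hz : χ (ρ⁻¹ • (w - c)) = 0 := by
    refine χ.zero_of_le_dist ?_
    rw [hχ, dist_zero_right, norm_smul, norm_inv, Real.norm_of_nonneg hρ.le]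
    rw [le_inv_mul_iff₀ hρ]
    linarith
  rw [hz, zero_smul]

/-- The topological support of the scaled slot function lies in the closed ball `B̄(c, 3ρ/2)`. [folklore] -/
theorem tsupport_slot_subset (χ : ContDiffBump (0 : EuclideanSpace ℝ ι)) (hχ : χ.rOut = 3 / 2) (κ : ι → ℤ)
    (h c : EuclideanSpace ℝ ι) {ρ : ℝ} (hρ : 0 < ρ) :
    tsupport (fun w : EuclideanSpace ℝ ι => χ (ρ⁻¹ • (w - c)) • eChar κ ((4 : ℝ)⁻¹ • (ρ⁻¹ • (w - c)) + h)) ⊆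
      Metric.closedBall c (3 / 2 * ρ) := by
  have hsupp : support (fun w : EuclideanSpace ℝ ι =>
      χ (ρ⁻¹ • (w - c)) • eChar κ ((4 : ℝ)⁻¹ • (ρ⁻¹ • (w - c)) + h)) ⊆ Metric.ball c (3 / 2 * ρ) := by
    intro w hw
    rw [Metric.mem_ball, dist_eq_norm]
    by_contra hcon
    exact hw (slot_eq_zero_of_le χ hχ κ h c hρ (not_lt.1 hcon))
  exact (closure_mono hsupp).trans Metric.closure_ball_subset_closedBall

/-- The scaled slot function has compact support. [folklore] -/
theorem hasCompactSupport_slot (χ : ContDiffBump (0 : EuclideanSpace ℝ ι)) (hχ : χ.rOut = 3 / 2) (κ : ι → ℤ)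
    (h c : EuclideanSpace ℝ ι) {ρ : ℝ} (hρ : 0 < ρ) :
    HasCompactSupport (fun w : EuclideanSpace ℝ ι =>
      χ (ρ⁻¹ • (w - c)) • eChar κ ((4 : ℝ)⁻¹ • (ρ⁻¹ • (w - c)) + h)) :=
  HasCompactSupport.intro (isCompact_closedBall c (3 / 2 * ρ)) fun w hw =>
    slot_eq_zero_of_le χ hχ κ h c hρ (by rw [Metric.mem_closedBall, dist_eq_norm, not_le] at hw; exact hw.le)

/-- The scaled slot function is smooth. [folklore] -/
theorem contDiff_slot (χ : ContDiffBump (0 : EuclideanSpace ℝ ι)) (κ : ι → ℤ) (h c : EuclideanSpace ℝ ι) (ρ : ℝ) :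
    ContDiff ℝ ∞ (fun w : EuclideanSpace ℝ ι =>
      χ (ρ⁻¹ • (w - c)) • eChar κ ((4 : ℝ)⁻¹ • (ρ⁻¹ • (w - c)) + h)) := by
  have hsm : ContDiff ℝ ∞ (fun u : EuclideanSpace ℝ ι => χ u • eChar κ ((4 : ℝ)⁻¹ • u + h)) :=
    χ.contDiff.smul ((contDiff_eChar κ).comp ((contDiff_const_smul _).add contDiff_const))
  exact hsm.comp ((contDiff_const_smul _).comp (contDiff_id.sub contDiff_const))

end Scaled

/-! ## Real and imaginary parts; the slot synthesis -/

section Synthesis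

variable {ι : Type*} [Fintype ι]

/-- Real/imaginary part of a smooth compactly supported `Θ : ℝ^ι → ℂ` through a real-linear `L : ℂ →L[ℝ] ℝ` of
norm `≤ 1`: smooth, compactly supported inside `tsupport Θ`, with the same derivative bounds. [folklore] -/
theorem clm_comp_slot_props {Θ : EuclideanSpace ℝ ι → ℂ} (hΘ : ContDiff ℝ ∞ Θ) (hcs : HasCompactSupport Θ)
    (L : ℂ →L[ℝ] ℝ) (hL : ‖L‖ ≤ 1) :
    ContDiff ℝ ∞ (fun w => L (Θ w)) ∧ HasCompactSupport (fun w => L (Θ w)) ∧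
      tsupport (fun w => L (Θ w)) ⊆ tsupport Θ ∧
      ∀ (m : ℕ) (w : EuclideanSpace ℝ ι), ‖iteratedFDeriv ℝ m (fun w => L (Θ w)) w‖ ≤ ‖iteratedFDeriv ℝ m Θ w‖ := by
  refine ⟨L.contDiff.comp hΘ, hcs.comp_left (g := fun z => L z) (map_zero L), ?_, fun m w => ?_⟩
  · exact closure_mono (support_comp_subset (g := fun z => L z) (map_zero L) Θ)
  · have h := L.norm_iteratedFDeriv_comp_left (f := Θ) (x := w) (n := m) (hΘ.contDiffAt) (by exact_mod_cast le_top)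
    refine h.trans ?_
    exact (mul_le_mul_of_nonneg_right hL (norm_nonneg _)).trans (le_of_eq (one_mul _))

/-- A Schwartz function on a finite-dimensional space is bounded. [folklore] -/
theorem exists_bound_schwartz {E : Type*} [NormedAddCommGroup E] [NormedSpace ℝ E] (b : SchwartzMap E ℝ) :
    ∃ Bb : ℝ, 0 ≤ Bb ∧ ∀ x, |b x| ≤ Bb := by
  obtain ⟨C, hC, h⟩ := b.decay 0 0
  refine ⟨C, hC.le, fun x => ?_⟩
  have := h x
  rw [pow_zero, one_mul, norm_iteratedFDeriv_zero, Real.norm_eq_abs] at this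
  exact this

/-- From the `tsum` identity of `SlotSynth` to a `HasSum` statement in `ℂ`. [folklore] -/
theorem hasSum_ofReal_atoms {E : Type*} [NormedAddCommGroup E] [NormedSpace ℝ E] (b : SchwartzMap E ℝ)
    {a : ℕ → ℝ} (ha : Summable fun i => |a i|) (σ : ℕ → ℝ) (η : ℕ → E) {ψ : E → ℝ}
    (hψ : ∀ z, ψ z = ∑' i, a i * b ((σ i)⁻¹ • (z - η i))) (z : E) :
    HasSum (fun i => (a i : ℂ) * (b ((σ i)⁻¹ • (z - η i)) : ℂ)) (ψ z : ℂ) := by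
  obtain ⟨Bb, hBb0, hBb⟩ := exists_bound_schwartz b
  have hsum : Summable fun i => a i * b ((σ i)⁻¹ • (z - η i)) := by
    refine Summable.of_norm_bounded (ha.mul_right Bb) fun i => ?_
    rw [Real.norm_eq_abs, abs_mul]
    exact mul_le_mul_of_nonneg_left (hBb _) (abs_nonneg _)
  have h := hsum.hasSum
  rw [← hψ z] at h
  simpa only [Complex.ofRealCLM_apply, Complex.ofReal_mul] using (Complex.ofRealCLM.hasSum h)

/-- **Slot synthesis.**  Under the single-slot property `SlotSynth b C₁ N₁`, a bump `χ` with `χ.rOut = 3/2` and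
derivative bounds `‖D^i χ‖ ≤ B` (`i ≤ N₁`): for every `κ ∈ ℤ⁴`, centre `c`, offset `h` and `ρ > 0` the slot function
`Θ(w) = χ(ρ⁻¹(w − c)) e_κ(4⁻¹ρ⁻¹(w − c) + h)` is an absolutely convergent complex series
`Θ(w) = ∑_ι A_ι b(σ_ι⁻¹(w − η_ι))` of `b`-atoms with `0 < σ_ι ≤ ρ`, `‖η_ι − c‖ ≤ 2ρ` and
`∑_ι ‖A_ι‖ ≤ 2 C₁ B (1 + (π/2)|κ|₁)^{N₁}`. [folklore] -/
theorem slot_hasSum_atoms {b : SchwartzMap (EuclideanSpace ℝ (Fin 4)) ℝ} {C₁ : ℝ} {N₁ : ℕ}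
    (hS : SlotSynth b C₁ N₁) (χ : ContDiffBump (0 : EuclideanSpace ℝ (Fin 4))) (hχ : χ.rOut = 3 / 2) {B : ℝ}
    (hB : ∀ i, i ≤ N₁ → ∀ y, ‖iteratedFDeriv ℝ i (fun y => χ y) y‖ ≤ B) (κ : Fin 4 → ℤ)
    (h c : EuclideanSpace ℝ (Fin 4)) {ρ : ℝ} (hρ : 0 < ρ) :
    ∃ (A : ℕ ⊕ ℕ → ℂ) (σ : ℕ ⊕ ℕ → ℝ) (η : ℕ ⊕ ℕ → EuclideanSpace ℝ (Fin 4)),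
      Summable (fun i => ‖A i‖) ∧ ∑' i, ‖A i‖ ≤ 2 * C₁ * (B * (1 + π / 2 * absSum κ) ^ N₁) ∧
      (∀ i, 0 < σ i ∧ σ i ≤ ρ ∧ ‖η i - c‖ ≤ 2 * ρ) ∧
      ∀ w, HasSum (fun i => A i * (b ((σ i)⁻¹ • (w - η i)) : ℂ))
        (χ (ρ⁻¹ • (w - c)) • eChar κ ((4 : ℝ)⁻¹ • (ρ⁻¹ • (w - c)) + h)) := by
  set Θ : EuclideanSpace ℝ (Fin 4) → ℂ :=
    fun w => χ (ρ⁻¹ • (w - c)) • eChar κ ((4 : ℝ)⁻¹ • (ρ⁻¹ • (w - c)) + h) with hΘdef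
  set M' : ℝ := B * (1 + π / 2 * absSum κ) ^ N₁ with hM'
  have hΘ : ContDiff ℝ ∞ Θ := contDiff_slot χ κ h c ρ
  have hcs : HasCompactSupport Θ := hasCompactSupport_slot χ hχ κ h c hρ
  have hts : tsupport Θ ⊆ Metric.closedBall c (3 / 2 * ρ) := tsupport_slot_subset χ hχ κ h c hρ
  have hder : ∀ m, m ≤ N₁ → ∀ w, ‖iteratedFDeriv ℝ m Θ w‖ ≤ M' / ρ ^ m :=
    fun m hm w => norm_iteratedFDeriv_slot_le χ hB κ h c hρ hm w
  -- real and imaginary parts as Schwartz functions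
  obtain ⟨hre_sm, hre_cs, hre_ts, hre_der⟩ := clm_comp_slot_props hΘ hcs reCLM (le_of_eq reCLM_norm)
  obtain ⟨him_sm, him_cs, him_ts, him_der⟩ := clm_comp_slot_props hΘ hcs imCLM (le_of_eq imCLM_norm)
  obtain ⟨ar, σr, ηr, har_sum, har_le, hr_geo, hr_eq⟩ := hS (hre_cs.toSchwartzMap hre_sm) c ρ M' hρ
    (hre_ts.trans hts) (fun m hm z => (hre_der m z).trans (hder m hm z))
  obtain ⟨ai, σi, ηi, hai_sum, hai_le, hi_geo, hi_eq⟩ := hS (him_cs.toSchwartzMap him_sm) c ρ M' hρ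
    (him_ts.trans hts) (fun m hm z => (him_der m z).trans (hder m hm z))
  -- the interleaved complex series
  refine ⟨Sum.elim (fun i => (ar i : ℂ)) (fun i => (ai i : ℂ) * I), Sum.elim σr σi, Sum.elim ηr ηi,
    ?_, ?_, ?_, fun w => ?_⟩
  · refine Summable.sum _ ?_ ?_
    · simpa [Function.comp_def] using har_sum
    · simpa [Function.comp_def] using hai_sum
  · have h1 : Summable fun i => ‖Sum.elim (fun i => (ar i : ℂ)) (fun i => (ai i : ℂ) * I) (Sum.inl i)‖ := by
      simpa using har_sum
    have h2 : Summable fun i => ‖Sum.elim (fun i => (ar i : ℂ)) (fun i => (ai i : ℂ) * I) (Sum.inr i)‖ := by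
      simpa using hai_sum
    rw [Summable.tsum_sum (f := fun i => ‖Sum.elim (fun i => (ar i : ℂ)) (fun i => (ai i : ℂ) * I) i‖)
      (by simpa [Function.comp_def] using h1) (by simpa [Function.comp_def] using h2)]
    simp only [Sum.elim_inl, Sum.elim_inr, Complex.norm_real, Real.norm_eq_abs, norm_mul, Complex.norm_I,
      mul_one]
    linarith
  · rintro (i | i)
    · exact hr_geo i
    · exact hi_geo i
  · have hr := hasSum_ofReal_atoms b har_sum σr ηr hr_eq w
    have hi := (hasSum_ofReal_atoms b hai_sum σi ηi hi_eq w).mul_right I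
    have hsum := HasSum.sum (f := fun i : ℕ ⊕ ℕ =>
        Sum.elim (fun i => (ar i : ℂ)) (fun i => (ai i : ℂ) * I) i *
          (b ((Sum.elim σr σi i)⁻¹ • (w - Sum.elim ηr ηi i)) : ℂ))
      (by simpa [Function.comp_def] using hr)
      (by simpa [Function.comp_def, mul_right_comm] using hi)
    have hval : (((Θ w).re : ℝ) : ℂ) + (((Θ w).im : ℝ) : ℂ) * I = Θ w := re_add_im _
    rw [hval] at hsum
    exact hsum

end Synthesis

end Summit.QuantumFields.YangMills.Theorems.AtomicSynthesisTensor

end
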